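import Summits.Langlands.Langlands.Theses.IrreducibilityBySelfDuality
import Summits.Langlands.Langlands.Theorems.HalfIntegralTwistCM.Negative.ModulusParallel
import Literature.NumberTheory.GaloisRepresentations.HeckeCharacterArchExistence
import Literature.NumberTheory.Automorphic.ClozelAlgebraicityRankOne
import Literature.NumberTheory.Automorphic.AutomorphicTwistNorm
import Literature.NumberTheory.Automorphic.ArchParameterTwistNorm
import Literature.NumberTheory.Automorphic.IdeleNormDetGL
import Literature.NumberTheory.NumberFields.ChevalleyUnitCongruence
import Mathlib.NumberTheory.Cyclotomic.Basic
import Summits.Langlands.Langlands.Theorems.IrreducibilityBySelfDualityHalfIntegralTwistCMChevalleyKummerField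
import Summits.Langlands.Langlands.Theorems.IrreducibilityBySelfDualityHalfIntegralTwistCMCyclotomicTwoPowerDescent
import Summits.Langlands.Langlands.Theorems.IrreducibilityBySelfDualityHalfIntegralTwistCMTwoPowChevalleyAssembly
import Summits.Langlands.Langlands.Theorems.IrreducibilityBySelfDualityHalfIntegralTwistCMCMDeepUnitsReal
import Summits.Langlands.Langlands.Theorems.IrreducibilityBySelfDualityHalfIntegralTwistCMUnitRelationCongruence
import Summits.Langlands.Langlands.Theorems.IrreducibilityBySelfDualityHalfIntegralTwistCMWeilExtension

/-!
# Line `two-primary-chevalley-core` for crux `HalfIntegralTwistCM` (stmt-Langlands-14036)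

Skeleton (crux-plan, planner, 2026-08-16) of the idea card
`Cruxes/HalfIntegralTwistCM/Ideas/two-primary-chevalley-core.md` (ideator 1, triage r1: pass ×3).

RESHAPE by the line lead (prover-line-stmt-Langlands-14036-0, 2026-08-16): the hardest stub S1
(`stub_twoPowChevalley`, 2-power Chevalley mod torsion) is cut into THREE registered stubs on PROVED
ground of the tree — the tree proves Artin reciprocity for characters
(`artinReciprocity_character_holds`) and the Kummer key step
`exists_pow_eq_of_local_pow_of_unit` (a `T`-unit which is a local `n`-th power at an admissible `T`
is a global `n`-th power, over a totally complex field containing `μ_n`):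
* `stub_chevalleyKummerField` (S1a): Chevalley's congruence theorem with EXACT `n`-th powers over a
  totally complex field containing a primitive `n`-th root of unity (key step + Hensel
  `exists_one_add_mul_pow_eq` + `exists_isAdmissible_superset`);
* `stub_cyclotomicTwoPowerDescent` (S1b): for a base `K ∋ √-1` the extension `K(ζ_{2^b})/K` loses
  no `2^b`-th powers (`Gal ⊂ {t ≡ 1 mod 4} ⊂ (ℤ/2^b)ˣ` is cyclic and `H¹(Gal, μ_{2^b}) = 0` by a
  2-adic valuation count — the Wang obstruction lives only at `K ⊂ K(i)`);
* `stub_twoPowChevalleyAssembly` (S1c): S1a → S1b → `UnitsCongruenceTwoPowModTorsion` (go up to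
  `F = K(ζ_{2^{b+1}})`, descend to `K(i)`, take the norm to `K`: `u² = y^{2^{b+1}}` gives
  `u = ζ y^{2^b}` with `ζ² = 1` — exactly the torsion slack of S1).
The composition `HalfIntegralTwistCM_of_statements` below is byte-identical to the planner's.

THE LINE.  Weil's unit criterion is run in CONGRUENCE form.  Four stub statements (S1 now derived from
S1a–S1c):

* `stub_unitRelationCongruence` (S3, Weil NECESSITY in congruence form, any totally complex field):
  the Hecke character of the given `GL₁` datum `ω` (exponents `E = s₁ + s₂`) has a level, so its
  archimedean unit product `∏_w (u_w/|u_w|)^{e_w} |u_w|^{i T_w}` (`e_w = E σ_w - E σ̄_w ∈ ℤ`,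
  `T_w = Im (E σ_w + E σ̄_w)`) is `1` on a congruence subgroup of units;
* `stub_cmDeepUnitsReal` (S4, the ONE place `IsCMField` enters): units `≡ 1 (mod a)` of a CM field
  are torsion-free and REAL under every complex embedding;
* `stub_twoPowChevalley` (S1 = A1 of the card, the hardest): 2-power Chevalley for the unit group
  modulo torsion — `u ≡ 1 (mod a) ⇒ u ∈ μ_K · 𝓞_Kˣ^(2^b)`;
* `stub_weilExtension` (S2 = A2 of the card = the shared "Tate seed", typed in the
  `unitArchProduct` / `HasUnitaryArchType` currency of the tree's named facts): a unitary archimedean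
  type killing a congruence subgroup of units is the type of a Hecke character.

and the KERNEL-CHECKED composition `HalfIntegralTwistCM_of_statements : S1 → S2 → S3 → S4 → crux` (axioms
`propext / Classical.choice / Quot.sound`; `HalfIntegralTwistCM_of` feeds it the four `stub_*`), which
carries the whole archimedean bookkeeping of the card: the parity computation (`e_w` even from
(i)+(ii)+(iii)), the trigonometric identity "`(type (n, -T/2) unit product)² · (type (e, T) unit
product) = 1` on real units" (so `ε := χ_∞|_{U}` is QUADRATIC on `U = U_{a₀} ∩ U_{a₁}`), the proved
group lemma `oddIndexAbsorption` (odd part of `[𝓞_Kˣ : U]` absorbed for free, so only exponent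
`2^(a+1)` is fed to S1), the modulus `r = (1 - σ)/2` from the PROVED parallel-real-parts lemma
`exists_re_archParam_parallel_glOne`, and the `GL₁` dictionary (`π_ψ ⊗ ‖·‖^r`, parameter by the PROVED
`archParam_of_hasUnitaryArchType` + `HasArchParameter.of_map_mulChar_detTwist`), ending with the
half-integrality check `p ι + s₁ ι - 1/2 ∈ ℤ` at both embeddings of every place.

Disproof obligations honoured (see the line card): (ii) is consumed in the definition of `n_w`
(`halfIntegralTwistCM_false_without_conjInt`), `IsCMField` exactly at S4
(`halfIntegralTwistCM_false_without_isCMField`, `…_of_isTotallyComplex`), (iii) in `M_w` and the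
evenness of `e_w` (F6), (iv) in S3 (F7), shifts `N_ι` place- and embedding-dependent (F9), no unitary /
real strengthening of `χ` (F3(c)): `χ = π_ψ ⊗ ‖·‖^r` keeps `Im p = -T_w/4`.
-/

set_option linter.dupNamespace false
set_option linter.unusedSectionVars false

noncomputable section

open scoped NumberField ComplexConjugate
open NumberField NumberField.InfinitePlace
open Literature.NumberTheory.Automorphic Literature.NumberTheory.GaloisRepresentations
open Summit.Langlands.Langlands.Theorems.HalfIntegralTwistCM.Negative

namespace Summit.Langlands.Langlands.Cruxes.HalfIntegralTwistCM.TwoPrimaryChevalleyCore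

/-- The crux under attack, by name. -/
abbrev Crux : Prop :=
  Summit.Langlands.Langlands.Theses.IrreducibilityBySelfDuality.HalfIntegralTwistCM

/-! ## The four stub statements -/

/-- (S1 = card A1) **2-power Chevalley for the unit group, modulo torsion.** For every number field
`K` and every `b` there is a rational modulus `a > 0` such that every unit `u ≡ 1 (mod a)` is a root
of unity times a `2^b`-th power of a unit.  Strictly weaker than the named fact
`Chevalley1951.thm1_units` (only 2-power exponents, torsion allowed; reduction
`unitsCongruenceTwoPowModTorsion_of_chevalley` below), and NECESSARY for the crux over CM fields by the
necessity note `Cruxes/HalfIntegralTwistCM/NecessityTwoPowerChevalley.md`.  Chevalley 1951 Thm 1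
(doi:10.2969/jmsj/00310036, §§3–5 + Remarque); engines on proved ground: `chebotarev_artinRep_holds`,
`KummerCharacter.*`, `HeckeCharacter.eq_one_of_forall_localUnits`. -/
def UnitsCongruenceTwoPowModTorsion : Prop :=
  ∀ (K : Type) [Field K] [NumberField K] (b : ℕ),
    ∃ a : ℕ, 0 < a ∧ ∀ u : (𝓞 K)ˣ, (a : 𝓞 K) ∣ (u : 𝓞 K) - 1 →
      ∃ ζ ∈ NumberField.Units.torsion K, ∃ w : (𝓞 K)ˣ, u = ζ * w ^ (2 ^ b)

/-- (S1a, lead's reshape) **Chevalley's congruence theorem over a Kummer field, exact powers.** For a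
totally complex number field `F` containing a primitive `n`-th root of unity (`n > 0`) there is a
rational modulus `a > 0` such that every unit `u ≡ 1 (mod a)` is the `n`-th power of a unit.
Proof on proved ground: `T ⊇ {v ∣ n}` admissible (`exists_isAdmissible_superset`), `a := n² · N(∏_{v∈T} 𝔭_v)`;
`u ≡ 1 (mod a)` is a local `n`-th power at every `v ∈ T` by Hensel (`exists_one_add_mul_pow_eq` in the
Henselian ring `𝒪_v`), a unit off `T`, hence a global `n`-th power by the Kummer key step
`exists_pow_eq_of_local_pow_of_unit artinReciprocity_character_holds` (Neukirch III (7.7)); an `n`-th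
root of a unit is a unit (`IsIntegral.of_pow`, `IsIntegrallyClosed`). Chevalley 1951 Thm 1 for `E = 𝓞_Fˣ`
when `μ_n ⊆ F` (doi:10.2969/jmsj/00310036). -/
def ChevalleyKummerField : Prop :=
  ∀ (F : Type) [Field F] [NumberField F] [IsTotallyComplex F] (n : ℕ), 0 < n →
    ∀ ζ : F, IsPrimitiveRoot ζ n →
      ∃ a : ℕ, 0 < a ∧ ∀ u : (𝓞 F)ˣ, (a : 𝓞 F) ∣ (u : 𝓞 F) - 1 → ∃ w : (𝓞 F)ˣ, u = w ^ n

/-- (S1b, lead's reshape) **Cyclotomic 2-power descent over a base containing `√-1`.** If `K ∋ i` with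
`i² = -1` and `F = K(ζ_{2^b})` (`IsCyclotomicExtension {2^b} K F`, `b ≥ 2`), then an element of `K`
which is a `2^b`-th power in `F` is a `2^b`-th power in `K`. Proof: `G = Gal(F/K)` embeds in
`{t ∈ (ℤ/2^b)ˣ : t ≡ 1 (mod 4)}` (its elements fix `i = ζ^{±2^{b-2}}`), a cyclic group (generated by `5`),
so `G = ⟨τ⟩`, `τ ζ = ζ^t`, `t ≡ 1 (mod 4)`; for `z^{2^b} = u ∈ K` the cocycle `τ z / z = ζ^x` satisfies
`x · (1 + t + ⋯ + t^{d-1}) ≡ 0 (mod 2^b)` (`d = |G|`), and the 2-adic count `v₂(1 + t + ⋯ + t^{d-1}) = v₂ d =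
b - v₂(t-1)` (lifting the exponent, `Int.two_pow_sub_pow`) forces `x ≡ (t-1) y`, so `z ζ^{-y}` is `G`-fixed:
`H¹(G, μ_{2^b}) = 0`. (Chevalley 1951 §3 / Artin–Tate Ch. IX §1: the special case lives only at `K ⊂ K(i)`.) -/
def CyclotomicTwoPowerDescent : Prop :=
  ∀ (K : Type) [Field K] [NumberField K] (F : Type) [Field F] [NumberField F] [Algebra K F] (b : ℕ),
    2 ≤ b → (∃ i : K, i ^ 2 = -1) → IsCyclotomicExtension {2 ^ b} K F →
      ∀ (u : K) (z : F), algebraMap K F u = z ^ 2 ^ b → ∃ y : K, u = y ^ 2 ^ b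

/-- (S2 = card A2, the shared "Tate seed") **Weil's extension theorem in CONGRUENCE form**, typed in
the currency of the tree's named facts (`unitArchProduct`, `HeckeCharacter.HasUnitaryArchType`): if
the unitary archimedean type `(m, t)` kills the global units `≡ 1 (mod a)`, then it is the archimedean
type of a Hecke character.  No Chevalley inside: define `χ₀(k · (x, y)) := F(x)` on the open
finite-index subgroup `Kˣ · ((K ⊗ ℝ)ˣ × Û_a)` of the ideles (`Kˣ ∩ ((K ⊗ ℝ)ˣ × Û_a) = U_a`), extend
through the finite quotient into the divisible group `ℂˣ`; continuity is automatic.  Template in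
tree: `HeckeCharacter.exists_of_isRayClassCharacter` (Tate, Prop. 4.1).  Weil 1956; Patrikis
arXiv:1207.6724 Lemma 2.1.1 (⇐ half, congruence hypothesis). -/
def WeilExtensionCongruence : Prop :=
  ∀ (K : Type) [Field K] [NumberField K] (m : InfinitePlace K → ℤ) (t : InfinitePlace K → ℝ)
    (a : ℕ), 0 < a →
    (∀ u : (𝓞 K)ˣ, (a : 𝓞 K) ∣ (u : 𝓞 K) - 1 → unitArchProduct K m t u = 1) →
      ∃ ψ : HeckeCharacter K, ψ.HasUnitaryArchType m t

/-- (S3) **Weil's NECESSITY in congruence form** (any totally complex number field, any `GL₁` datum):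
if `ω` has archimedean parameter `{E ι}` then `e_w := E σ_w - E σ̄_w` is an integer
(`archParam_embedding_sub_conj_mem_int_glOne`, proved) and the unit product of unitary type
`(e_w, T_w)`, `T_w = Im (E σ_w + E σ̄_w)`, is `1` on the units `≡ 1 (mod a)` for some `a > 0`.
Proof sketch: `θ = χ_ω` (`exists_heckeCharacter_glOne`) has a level `𝔪` (`exists_level_glOne`,
proved), so `θ((1, u_f)) = 1` for `u ≡ 1 (𝔪)` and hence `θ((u_∞, 1)) = 1`; by
`archParam_complexPlace_glOne` (proved) `θ((u_∞,1)) = ∏_w e^{a_w E σ_w + ā_w E σ̄_w}`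
(`e^{a_w} = σ_w u`) `= (∏_w |u_w|²)^σ · ∏_w archUnitaryValue e_w T_w (σ_w u)` and `∏_w |u_w|² = |N u| = 1`
(cf. the disprover's finite-exponent version `unit_relation_glOne`, Disproof §10). -/
def UnitRelationCongruence : Prop :=
  ∀ (K : Type) [Field K] [NumberField K] [IsTotallyComplex K]
    (h1 : isCompact_glFiniteIntegralLevel 1 K) (ω : CuspidalAutomorphicRepData 1 K h1)
    (E : (K →+* ℂ) → ℂ), ω.1.HasArchParameter (fun ι => {E ι}) →
      ∃ (e : InfinitePlace K → ℤ) (a : ℕ), 0 < a ∧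
        (∀ w : InfinitePlace K,
          (e w : ℂ) = E w.embedding - E (ComplexEmbedding.conjugate w.embedding)) ∧
        ∀ u : (𝓞 K)ˣ, (a : 𝓞 K) ∣ (u : 𝓞 K) - 1 →
          unitArchProduct K e
            (fun w => (E w.embedding + E (ComplexEmbedding.conjugate w.embedding)).im) u = 1

/-- (S4) **Deep units of a CM field are torsion-free and real** (the ONE place where `IsCMField` is
used on this line): there is `a > 0` (any `a ≥ 3` works) such that every unit `u ≡ 1 (mod a)` is
(a) of infinite order unless `u = 1` (`|N(ζ - 1)| ≤ 2^{[K:ℚ]}` for roots of unity) and (b) real under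
every complex embedding (`u/ū` is a root of unity `≡ 1 (mod a)`, hence `1`, so `u ∈ K⁺`; Mathlib
`IsCMField.unitsMulComplexConjInv`, values in `torsion K`). -/
def CMDeepUnitsReal : Prop :=
  ∀ (K : Type) [Field K] [NumberField K], IsCMField K →
    ∃ a : ℕ, 0 < a ∧ ∀ u : (𝓞 K)ˣ, (a : 𝓞 K) ∣ (u : 𝓞 K) - 1 →
      (IsOfFinOrder u → u = 1) ∧ ∀ φ : K →+* ℂ, conj (φ ((u : 𝓞 K) : K)) = φ ((u : 𝓞 K) : K)

/-! ## Registered stubs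

Each stub is stated IN FULL (the registered signature is the statement itself, readable without this
file); it is definitionally the named `Prop` above (`stub_x : X` would do — the kernel accepts either in
`HalfIntegralTwistCM_of`). -/

/-- S1a = `ChevalleyKummerField` (Kummer key step `exists_pow_eq_of_local_pow_of_unit` with
`artinReciprocity_character_holds` + Hensel `exists_one_add_mul_pow_eq` + `exists_isAdmissible_superset`;
size M). -/
theorem stub_chevalleyKummerField :
    ∀ (F : Type) [Field F] [NumberField F] [IsTotallyComplex F] (n : ℕ), 0 < n →
      ∀ ζ : F, IsPrimitiveRoot ζ n →
        ∃ a : ℕ, 0 < a ∧ ∀ u : (𝓞 F)ˣ, (a : 𝓞 F) ∣ (u : 𝓞 F) - 1 → ∃ w : (𝓞 F)ˣ, u = w ^ n :=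
  -- LANDED (p86204): Theorems/IrreducibilityBySelfDualityHalfIntegralTwistCMChevalleyKummerField.lean
  Summit.Langlands.Langlands.Theorems.HalfIntegralTwistCM.stub_chevalleyKummerField

/-- S1b = `CyclotomicTwoPowerDescent` (cyclicity of `{t ≡ 1 mod 4} ≤ (ℤ/2^b)ˣ` + the 2-adic count
`H¹(Gal(K(ζ_{2^b})/K), μ_{2^b}) = 0` for `K ∋ √-1`; size M–L). -/
theorem stub_cyclotomicTwoPowerDescent :
    ∀ (K : Type) [Field K] [NumberField K] (F : Type) [Field F] [NumberField F] [Algebra K F] (b : ℕ),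
      2 ≤ b → (∃ i : K, i ^ 2 = -1) → IsCyclotomicExtension {2 ^ b} K F →
        ∀ (u : K) (z : F), algebraMap K F u = z ^ 2 ^ b → ∃ y : K, u = y ^ 2 ^ b :=
  -- LANDED (p87437): Theorems/IrreducibilityBySelfDualityHalfIntegralTwistCMCyclotomicTwoPowerDescent.lean
  Summit.Langlands.Langlands.Theorems.HalfIntegralTwistCM.stub_cyclotomicTwoPowerDescent

/-- S1c = the assembly `ChevalleyKummerField → CyclotomicTwoPowerDescent → UnitsCongruenceTwoPowModTorsion`
(stated in full): `b = 0` trivial; for `b ≥ 1` go up to `F = CyclotomicField (2^(b+1)) K` (totally complex: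
it contains `√-1`), get `u = w^{2^{b+1}}` in `F` from S1a with `n = 2^{b+1}` (the modulus `a` of `𝓞_F` read in
`𝓞_K`), descend to `K' = K⟮i⟯ ⊆ F` by S1b (`F/K'` is `{2^{b+1}}`-cyclotomic), and take `N_{K'/K}`:
`u^{[K':K]} = y^{2^{b+1}}` with `[K':K] ∣ 2`, `y = N(y')` a unit of `K`, so `u = ζ · y^{2^b}` (or `(y²)^{2^b}`)
with `ζ² = 1`, `ζ ∈ torsion K`; size M. -/
theorem stub_twoPowChevalleyAssembly :
    (∀ (F : Type) [Field F] [NumberField F] [IsTotallyComplex F] (n : ℕ), 0 < n →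
      ∀ ζ : F, IsPrimitiveRoot ζ n →
        ∃ a : ℕ, 0 < a ∧ ∀ u : (𝓞 F)ˣ, (a : 𝓞 F) ∣ (u : 𝓞 F) - 1 → ∃ w : (𝓞 F)ˣ, u = w ^ n) →
    (∀ (K : Type) [Field K] [NumberField K] (F : Type) [Field F] [NumberField F] [Algebra K F] (b : ℕ),
      2 ≤ b → (∃ i : K, i ^ 2 = -1) → IsCyclotomicExtension {2 ^ b} K F →
        ∀ (u : K) (z : F), algebraMap K F u = z ^ 2 ^ b → ∃ y : K, u = y ^ 2 ^ b) →
    ∀ (K : Type) [Field K] [NumberField K] (b : ℕ),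
      ∃ a : ℕ, 0 < a ∧ ∀ u : (𝓞 K)ˣ, (a : 𝓞 K) ∣ (u : 𝓞 K) - 1 →
        ∃ ζ ∈ NumberField.Units.torsion K, ∃ w : (𝓞 K)ˣ, u = ζ * w ^ (2 ^ b) :=
  -- LANDED (p87282): Theorems/IrreducibilityBySelfDualityHalfIntegralTwistCMTwoPowChevalleyAssembly.lean
  Summit.Langlands.Langlands.Theorems.HalfIntegralTwistCM.stub_twoPowChevalleyAssembly

/-- S1 = `UnitsCongruenceTwoPowModTorsion`, now DERIVED from the three registered stubs S1a, S1b, S1c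
(no `sorry` of its own). -/
theorem stub_twoPowChevalley :
    ∀ (K : Type) [Field K] [NumberField K] (b : ℕ),
      ∃ a : ℕ, 0 < a ∧ ∀ u : (𝓞 K)ˣ, (a : 𝓞 K) ∣ (u : 𝓞 K) - 1 →
        ∃ ζ ∈ NumberField.Units.torsion K, ∃ w : (𝓞 K)ˣ, u = ζ * w ^ (2 ^ b) :=
  stub_twoPowChevalleyAssembly stub_chevalleyKummerField stub_cyclotomicTwoPowerDescent

/-- S2 = `WeilExtensionCongruence` (Weil/Tate extension from the open subgroup `Kˣ·((K⊗ℝ)ˣ × Û_a)`;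
size M–L; template `HeckeCharacter.exists_of_isRayClassCharacter`).  SHARED STUB: stated with the same
binders and the same signature text as `stub_weilExtension` of the sibling line
`Lines/chevalley_exponent_saturation.lean` (registered on stmt-Langlands-14036 at 05:44Z), so ONE proof serves
both lines; `∏ w, archUnitaryValue …` is `unitArchProduct K m t u` by `rfl` (`unitArchProduct_eq`). -/
theorem stub_weilExtension (K : Type) [Field K] [NumberField K]
    (m : InfinitePlace K → ℤ) (t : InfinitePlace K → ℝ) (a : ℕ) (ha : 0 < a)
    (h : ∀ u : (𝓞 K)ˣ, (a : 𝓞 K) ∣ (u : 𝓞 K) - 1 →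
      ∏ w : InfinitePlace K, archUnitaryValue (m w) (t w) (w.embedding ((u : 𝓞 K) : K)) = 1) :
    ∃ ψ : HeckeCharacter K, ψ.HasUnitaryArchType m t :=
  -- LANDED (p90397): Theorems/IrreducibilityBySelfDualityHalfIntegralTwistCMWeilExtension.lean
  Summit.Langlands.Langlands.Theorems.HalfIntegralTwistCM.stub_weilExtension K m t a ha h

/-- S3 = `UnitRelationCongruence` (Weil necessity, congruence form; level of `χ_ω`
(`HeckeCharacter.exists_level_glOne`) + the exponential formula for `θ_∞`
(`archParam_complexPlace_glOne`, cf. Disproof §10 `heckeCharacter_infiniteIdeles_eq_exp_sum`); size M). -/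
theorem stub_unitRelationCongruence :
    ∀ (K : Type) [Field K] [NumberField K] [IsTotallyComplex K]
      (h1 : isCompact_glFiniteIntegralLevel 1 K) (ω : CuspidalAutomorphicRepData 1 K h1)
      (E : (K →+* ℂ) → ℂ), ω.1.HasArchParameter (fun ι => {E ι}) →
        ∃ (e : InfinitePlace K → ℤ) (a : ℕ), 0 < a ∧
          (∀ w : InfinitePlace K,
            (e w : ℂ) = E w.embedding - E (ComplexEmbedding.conjugate w.embedding)) ∧
          ∀ u : (𝓞 K)ˣ, (a : 𝓞 K) ∣ (u : 𝓞 K) - 1 →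
            unitArchProduct K e
              (fun w => (E w.embedding + E (ComplexEmbedding.conjugate w.embedding)).im) u = 1 :=
  -- LANDED (p89427): Theorems/IrreducibilityBySelfDualityHalfIntegralTwistCMUnitRelationCongruence.lean
  Summit.Langlands.Langlands.Theorems.HalfIntegralTwistCM.stub_unitRelationCongruence

/-- S4 = `CMDeepUnitsReal` (elementary CM: units `≡ 1 (mod a)`, `a ≥ 3`, are torsion-free —
`|N(ζ-1)|` is `1` or `ℓ^{[K:ℚ(ζ)]}` — and real — `u/ū ∈ torsion ∩ U_a = 1`,
`IsCMField.unitsMulComplexConjInv`; size S–M). -/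
theorem stub_cmDeepUnitsReal :
    ∀ (K : Type) [Field K] [NumberField K], IsCMField K →
      ∃ a : ℕ, 0 < a ∧ ∀ u : (𝓞 K)ˣ, (a : 𝓞 K) ∣ (u : 𝓞 K) - 1 →
        (IsOfFinOrder u → u = 1) ∧
          ∀ φ : K →+* ℂ, conj (φ ((u : 𝓞 K) : K)) = φ ((u : 𝓞 K) : K) :=
  -- LANDED (p87243): Theorems/IrreducibilityBySelfDualityHalfIntegralTwistCMCMDeepUnitsReal.lean
  Summit.Langlands.Langlands.Theorems.HalfIntegralTwistCM.stub_cmDeepUnitsReal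

/-! ## Sanity: S1 is below the tree's named fact -/

/-- `Chevalley1951.thm1_units` (general exponent, exact powers) implies S1. -/
theorem unitsCongruenceTwoPowModTorsion_of_chevalley
    (h : Literature.NumberTheory.NumberFields.Chevalley1951.thm1_units) :
    UnitsCongruenceTwoPowModTorsion := by
  intro K _ _ b
  obtain ⟨a, ha, -, h⟩ := h K (2 ^ b) (by positivity) 1 Nat.one_pos
  exact ⟨a, ha, fun u hu => ⟨1, one_mem _, (h u hu).imp fun w hw => by simpa using hw⟩⟩

/-! ## Proved glue I: congruence subgroups of units -/

section Helpers

variable {K : Type} [Field K] [NumberField K]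

variable (K) in
/-- The congruence subgroup `U_a = {u ∈ 𝓞_Kˣ : u ≡ 1 (mod a)}`, as the kernel of
`𝓞_Kˣ → (𝓞_K / a)ˣ`. -/
def congrUnits (a : ℕ) : Subgroup (𝓞 K)ˣ :=
  (Units.map (Ideal.Quotient.mk (Ideal.span {(a : 𝓞 K)})).toMonoidHom).ker

theorem mem_congrUnits {a : ℕ} {u : (𝓞 K)ˣ} :
    u ∈ congrUnits K a ↔ (a : 𝓞 K) ∣ (u : 𝓞 K) - 1 := by
  simp only [congrUnits, MonoidHom.mem_ker, Units.ext_iff, Units.coe_map, RingHom.toMonoidHom_eq_coe,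
    MonoidHom.coe_coe, Units.val_one]
  rw [← map_one (Ideal.Quotient.mk (Ideal.span {(a : 𝓞 K)})), Ideal.Quotient.eq,
    Ideal.mem_span_singleton]

theorem congrUnits_index_ne_zero {a : ℕ} (ha : 0 < a) : (congrUnits K a).index ≠ 0 := by
  have hI : Ideal.span {(a : 𝓞 K)} ≠ ⊥ := by
    rw [Ne, Ideal.span_singleton_eq_bot]
    exact_mod_cast ha.ne'
  haveI : Finite (𝓞 K ⧸ Ideal.span {(a : 𝓞 K)}) := Ideal.finiteQuotientOfFreeOfNeBot _ hI
  unfold congrUnits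
  exact Subgroup.FiniteIndex.index_ne_zero

/-! ## Proved glue II: the unit product as a character -/

theorem unitArchProduct_eq (m : InfinitePlace K → ℤ) (t : InfinitePlace K → ℝ) (α : (𝓞 K)ˣ) :
    unitArchProduct K m t α =
      ∏ w : InfinitePlace K, archUnitaryValue (m w) (t w) (w.embedding ((α : 𝓞 K) : K)) :=
  rfl

theorem archUnitaryValue_mul {z z' : ℂ} (m : ℤ) (t : ℝ) :
    archUnitaryValue m t (z * z') = archUnitaryValue m t z * archUnitaryValue m t z' := by
  unfold archUnitaryValue
  rw [norm_mul, Complex.ofReal_mul, Complex.mul_cpow_ofReal_nonneg (norm_nonneg _) (norm_nonneg _),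
    mul_div_mul_comm, mul_zpow]
  ring

theorem embedding_unit_ne_zero (w : InfinitePlace K) (α : (𝓞 K)ˣ) :
    w.embedding ((α : 𝓞 K) : K) ≠ 0 :=
  (map_ne_zero _).mpr (RingOfIntegers.coe_ne_zero_iff.mpr (Units.ne_zero α))

theorem unitArchProduct_ne_zero (m : InfinitePlace K → ℤ) (t : InfinitePlace K → ℝ) (α : (𝓞 K)ˣ) :
    unitArchProduct K m t α ≠ 0 := by
  rw [unitArchProduct_eq]
  exact Finset.prod_ne_zero_iff.mpr fun w _ => norm_ne_zero_iff.mp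
    (by rw [norm_archUnitaryValue (embedding_unit_ne_zero w α)]; exact one_ne_zero)

theorem unitArchProduct_mul (m : InfinitePlace K → ℤ) (t : InfinitePlace K → ℝ) (α β : (𝓞 K)ˣ) :
    unitArchProduct K m t (α * β) = unitArchProduct K m t α * unitArchProduct K m t β := by
  simp only [unitArchProduct_eq, Units.val_mul, map_mul, ← Finset.prod_mul_distrib]
  exact Finset.prod_congr rfl fun w _ => archUnitaryValue_mul _ _

theorem unitArchProduct_one (m : InfinitePlace K → ℤ) (t : InfinitePlace K → ℝ) :
    unitArchProduct K m t 1 = 1 := by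
  simp only [unitArchProduct_eq, Units.val_one, map_one, archUnitaryValue_one, Finset.prod_const_one]

variable (K) in
/-- The unit product of type `(m, t)` as a character `𝓞_Kˣ → ℂˣ`. -/
def unitArchProductHom (m : InfinitePlace K → ℤ) (t : InfinitePlace K → ℝ) : (𝓞 K)ˣ →* ℂˣ where
  toFun α := Units.mk0 (unitArchProduct K m t α) (unitArchProduct_ne_zero m t α)
  map_one' := Units.ext (by rw [Units.val_mk0, Units.val_one, unitArchProduct_one])
  map_mul' α β := Units.ext (by
    rw [Units.val_mul, Units.val_mk0, Units.val_mk0, Units.val_mk0, unitArchProduct_mul])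

@[simp] theorem val_unitArchProductHom (m : InfinitePlace K → ℤ) (t : InfinitePlace K → ℝ)
    (α : (𝓞 K)ˣ) : ((unitArchProductHom K m t α : ℂˣ) : ℂ) = unitArchProduct K m t α :=
  rfl

/-! ## Proved glue III: the trigonometric identity on real units (the "quadratic shadow") -/

/-- For a non-zero REAL complex number `z`, an even `e` and any `n`, `T`:
`archUnitaryValue n (-T/2) z ^ 2 * archUnitaryValue e T z = 1`
(`(±1)^{2n+e} = 1` and `|z|^{-iT/2·2} |z|^{iT} = 1`). -/
theorem archUnitaryValue_sq_mul_eq_one_of_conj_eq {z : ℂ} (hz : z ≠ 0) (hreal : conj z = z)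
    (n e : ℤ) (he : Even e) (T : ℝ) :
    archUnitaryValue n (-T / 2) z ^ 2 * archUnitaryValue e T z = 1 := by
  obtain ⟨e', rfl⟩ := he
  have hz' : ((z.re : ℝ) : ℂ) = z := Complex.conj_eq_iff_re.mp hreal
  have hr : z.re ≠ 0 := fun h => hz (by rw [← hz', h, Complex.ofReal_zero])
  rw [← hz']
  generalize z.re = r at hr
  unfold archUnitaryValue
  rw [Complex.norm_real, Real.norm_eq_abs]
  have habs : ((|r| : ℝ) : ℂ) ≠ 0 := by exact_mod_cast abs_ne_zero.mpr hr
  have hx : (r : ℂ) / ((|r| : ℝ) : ℂ) ≠ 0 := div_ne_zero (by exact_mod_cast hr) habs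
  have hsq : ((r : ℂ) / ((|r| : ℝ) : ℂ)) ^ (2 : ℤ) = 1 := by
    rw [zpow_ofNat, div_pow, ← Complex.ofReal_pow, ← Complex.ofReal_pow, sq_abs, div_self]
    exact_mod_cast pow_ne_zero 2 hr
  have hang : (((r : ℂ) / ((|r| : ℝ) : ℂ)) ^ n) ^ 2 * ((r : ℂ) / ((|r| : ℝ) : ℂ)) ^ (e' + e') = 1 := by
    rw [← zpow_natCast, ← zpow_mul, ← zpow_add₀ hx,
      show n * ((2 : ℕ) : ℤ) + (e' + e') = 2 * (n + e') by push_cast; ring, zpow_mul, hsq, one_zpow]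
  have hmod : ((((|r| : ℝ) : ℂ)) ^ (((-T / 2 : ℝ) : ℂ) * Complex.I)) ^ 2 *
      (((|r| : ℝ) : ℂ)) ^ ((T : ℂ) * Complex.I) = 1 := by
    rw [sq, ← Complex.cpow_add _ _ habs, ← Complex.cpow_add _ _ habs,
      show ((-T / 2 : ℝ) : ℂ) * Complex.I + ((-T / 2 : ℝ) : ℂ) * Complex.I + (T : ℂ) * Complex.I = 0 by
        push_cast; ring, Complex.cpow_zero]
  calc _ = ((((r : ℂ) / ((|r| : ℝ) : ℂ)) ^ n) ^ 2 * ((r : ℂ) / ((|r| : ℝ) : ℂ)) ^ (e' + e')) *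
        (((((|r| : ℝ) : ℂ)) ^ (((-T / 2 : ℝ) : ℂ) * Complex.I)) ^ 2 *
          (((|r| : ℝ) : ℂ)) ^ ((T : ℂ) * Complex.I)) := by ring
    _ = 1 := by rw [hang, hmod, one_mul]

/-- On a unit that is real under every embedding, the unit product of type `(n, -T/2)` squares to
the inverse of the unit product of type `(e, T)` when all `e_w` are even. -/
theorem unitArchProduct_sq_mul_eq_one {n e : InfinitePlace K → ℤ} (he : ∀ w, Even (e w))
    (T : InfinitePlace K → ℝ) {u : (𝓞 K)ˣ}
    (hreal : ∀ φ : K →+* ℂ, conj (φ ((u : 𝓞 K) : K)) = φ ((u : 𝓞 K) : K)) :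
    unitArchProduct K n (fun w => -(T w) / 2) u ^ 2 * unitArchProduct K e T u = 1 := by
  simp only [unitArchProduct_eq]
  rw [← Finset.prod_pow, ← Finset.prod_mul_distrib]
  exact Finset.prod_eq_one fun w _ =>
    archUnitaryValue_sq_mul_eq_one_of_conj_eq (embedding_unit_ne_zero w u) (hreal _) _ _ (he w) _

end Helpers

/-! ## Proved glue IV: odd-index absorption (ideator 1, `SketchIdeator1.oddIndexAbsorption`) -/

/-- **Odd-index absorption** (pure group theory; proof copied from the ideator's sketch, kernel-checked
there and here): `V ≤ U` of index `2^a · n`, `n` odd, `V` torsion-free, `ε` a character of `V`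
trivial on squares; then `ε` kills every element of `V` of the form `ζ · w^(2^(a+1))`, `ζ` torsion. -/
theorem oddIndexAbsorption {U : Type*} [CommGroup U] (V : Subgroup U) (a n : ℕ) (hn : Odd n)
    (hidx : V.index = 2 ^ a * n) (htf : ∀ v ∈ V, IsOfFinOrder v → v = 1)
    (ε : V →* ℂˣ) (hε : ∀ v : V, ε (v ^ 2) = 1)
    (u : V) (ζ w : U) (hζ : IsOfFinOrder ζ) (hu : (u : U) = ζ * w ^ (2 ^ (a + 1))) :
    ε u = 1 := by
  have hw : w ^ (2 ^ a * n) ∈ V := hidx ▸ V.pow_index_mem w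
  set v₀ : V := ⟨w ^ (2 ^ a * n), hw⟩ with hv₀
  have hpow : (u : U) ^ n = ζ ^ n * (v₀ : U) ^ 2 := by
    rw [hu, mul_pow, ← pow_mul, hv₀, Subgroup.coe_mk, ← pow_mul,
      show 2 ^ a * n * 2 = 2 ^ (a + 1) * n by ring]
  have hζn_mem : ζ ^ n ∈ V := by
    have h : (u : U) ^ n * ((v₀ : U) ^ 2)⁻¹ = ζ ^ n := by rw [hpow, mul_inv_cancel_right]
    rw [← h]
    exact V.mul_mem (V.pow_mem u.2 n) (V.inv_mem (V.pow_mem v₀.2 2))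
  have hζn : ζ ^ n = 1 := htf _ hζn_mem hζ.pow
  have hun : u ^ n = v₀ ^ 2 := by
    apply Subtype.ext
    rw [SubgroupClass.coe_pow, SubgroupClass.coe_pow, hpow, hζn, one_mul]
  have h1 : ε u ^ n = 1 := by rw [← map_pow, hun, hε]
  have h2 : ε u ^ 2 = 1 := by rw [← map_pow]; exact hε u
  obtain ⟨k, rfl⟩ := hn
  have h3 : ε u ^ (2 * k + 1) = (ε u ^ 2) ^ k * ε u := by rw [pow_succ, pow_mul]
  rw [h2, one_pow, one_mul, h1] at h3
  exact h3.symm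

/-! ## The composition -/

/-- **The glue, hypothesis form** (kernel-checked, axioms `propext / Classical.choice / Quot.sound`):
the four stub STATEMENTS imply the crux — S1 → S2 → S3 → S4 → `HalfIntegralTwistCM` — by the
congruence form of Weil's criterion with odd-index absorption (all archimedean bookkeeping done here).
Concludes the local abbreviation `Crux` so that exactly one theorem of this file,
`HalfIntegralTwistCM_of` below, concludes the route decl by name. -/
theorem HalfIntegralTwistCM_of_statements :
    UnitsCongruenceTwoPowModTorsion → WeilExtensionCongruence → UnitRelationCongruence →
      CMDeepUnitsReal → Crux := by
  intro hS1 hS2 hS3 hS4 K _ _ hK hcpt s₁ s₂ hi hii hiii hω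
  classical
  obtain ⟨ω, hω⟩ := hω
  haveI : IsCMField K := hK
  have hcx : ∀ w : InfinitePlace K, w.IsComplex := IsTotallyComplex.isComplex
  -- (S3) Weil necessity in congruence form for `ω`, exponents `E = s₁ + s₂`
  obtain ⟨e, a₀, ha₀, he, hkill₀⟩ := hS3 K hcpt ω (fun ι => s₁ ι + s₂ ι) hω
  -- real parts of the exponents are parallel (proved in the tree)
  obtain ⟨σ, -, hσ⟩ := exists_re_archParam_parallel_glOne ω.1 hω
  -- (S4) deep units are torsion-free and real
  obtain ⟨a₁, ha₁, hdeep⟩ := hS4 K hK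
  -- the integers of hypotheses (i), (ii), (iii)
  choose kk hkk using hi
  choose mII hmII using hii
  choose MM hMM using hiii
  -- notation: `T_w = Im E⁺_w`, `n_w = m_w + M_w`, unitary type `(n, -T/2)`
  set T : InfinitePlace K → ℝ :=
    fun w => (s₁ w.embedding + s₂ w.embedding +
      (s₁ (ComplexEmbedding.conjugate w.embedding) + s₂ (ComplexEmbedding.conjugate w.embedding))).im
    with hT
  set n : InfinitePlace K → ℤ := fun w => mII w.embedding + MM w.embedding with hn
  -- `E⁺_w = 2σ + i T_w`
  have hEsum : ∀ w : InfinitePlace K,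
      s₁ w.embedding + s₂ w.embedding +
        (s₁ (ComplexEmbedding.conjugate w.embedding) + s₂ (ComplexEmbedding.conjugate w.embedding)) =
        2 * σ + T w * Complex.I := by
    intro w
    have hre := hσ ⟨w, hcx w⟩ (s₁ w.embedding + s₂ w.embedding)
      (s₁ (ComplexEmbedding.conjugate w.embedding) + s₂ (ComplexEmbedding.conjugate w.embedding))
      rfl rfl
    apply Complex.ext
    · rw [hre]; simp
    · simp [hT]
  -- the angular integers `e_w` are even ((i) + (ii) + (iii))
  have heven : ∀ w, Even (e w) := by
    intro w
    have h1' := hkk w.embedding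
    have h3' := hmII w.embedding
    have h4' := hMM w.embedding
    have key : ((e w : ℤ) : ℂ) =
        ((2 * (mII w.embedding + MM w.embedding - kk w.embedding) : ℤ) : ℂ) := by
      rw [he w]
      push_cast
      linear_combination -2 * h1' + 2 * h3' + h4'
    exact ⟨mII w.embedding + MM w.embedding - kk w.embedding, by
      rw [Int.cast_injective key]; ring⟩
  -- the quadratic shadow: `(unit product of type (n, -T/2))² = 1` on `U_{a₀} ∩ U_{a₁}`
  have hsq : ∀ u : (𝓞 K)ˣ, (a₀ : 𝓞 K) ∣ (u : 𝓞 K) - 1 → (a₁ : 𝓞 K) ∣ (u : 𝓞 K) - 1 →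
      unitArchProduct K n (fun w => -(T w) / 2) u ^ 2 = 1 := by
    intro u hu₀ hu₁
    have h := unitArchProduct_sq_mul_eq_one (n := n) heven T (hdeep u hu₁).2
    have h0 : unitArchProduct K e T u = 1 := hkill₀ u hu₀
    rwa [h0, mul_one] at h
  -- divisibility bookkeeping
  have hdvd : ∀ {u : (𝓞 K)ˣ} (c d : ℕ), ((c * d : ℕ) : 𝓞 K) ∣ (u : 𝓞 K) - 1 →
      (c : 𝓞 K) ∣ (u : 𝓞 K) - 1 ∧ (d : 𝓞 K) ∣ (u : 𝓞 K) - 1 := fun c d h =>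
    ⟨(Dvd.intro (d : 𝓞 K) (by push_cast; ring)).trans h,
      (Dvd.intro (c : 𝓞 K) (by push_cast; ring)).trans h⟩
  -- the congruence subgroup `V = U_{a₀ a₁}` has index `2^a · (odd)`
  obtain ⟨a, nn, hnn, hidx⟩ :=
    Nat.exists_eq_two_pow_mul_odd (congrUnits_index_ne_zero (K := K) (Nat.mul_pos ha₀ ha₁))
  -- (S1) 2-power Chevalley modulo torsion, exponent `2^(a+1)`
  obtain ⟨a₂, ha₂, hpow⟩ := hS1 K (a + 1)
  -- odd-index absorption: the type `(n, -T/2)` kills `U_{a₀ a₁ a₂}`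
  have hkill : ∀ u : (𝓞 K)ˣ, ((a₀ * a₁ * a₂ : ℕ) : 𝓞 K) ∣ (u : 𝓞 K) - 1 →
      unitArchProduct K n (fun w => -(T w) / 2) u = 1 := by
    intro u hu
    obtain ⟨hu01, hu2⟩ := hdvd (a₀ * a₁) a₂ hu
    obtain ⟨ζ, hζ, w, hw⟩ := hpow u hu2
    set V : Subgroup (𝓞 K)ˣ := congrUnits K (a₀ * a₁) with hV
    let ε : V →* ℂˣ := (unitArchProductHom K n (fun w => -(T w) / 2)).comp V.subtype
    have hεsq : ∀ v : V, ε (v ^ 2) = 1 := by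
      intro v
      obtain ⟨hv0, hv1⟩ := hdvd a₀ a₁ (mem_congrUnits.mp v.2)
      rw [map_pow]
      ext
      rw [Units.val_pow_eq_pow_val, Units.val_one]
      exact hsq v hv0 hv1
    have htf : ∀ v ∈ V, IsOfFinOrder v → v = 1 := fun v hv hfin =>
      (hdeep v (hdvd a₀ a₁ (mem_congrUnits.mp hv)).2).1 hfin
    have hζfin : IsOfFinOrder ζ := (CommGroup.mem_torsion _).mp hζ
    have key := oddIndexAbsorption V a nn hnn hidx htf ε hεsq ⟨u, mem_congrUnits.mpr hu01⟩ ζ w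
      hζfin hw
    have key' := congrArg (fun x : ℂˣ => (x : ℂ)) key
    simpa [ε] using key'
  -- (S2) Weil extension: a Hecke character `ψ` of unitary type `(n, -T/2)`
  obtain ⟨ψ, hψ⟩ := hS2 K n (fun w => -(T w) / 2) (a₀ * a₁ * a₂)
    (Nat.mul_pos (Nat.mul_pos ha₀ ha₁) ha₂) hkill
  -- GL(1) dictionary: `χ := π_ψ ⊗ ‖·‖^r`, `r = (1 - σ)/2`
  set r : ℝ := (1 - σ) / 2 with hr
  obtain ⟨χr, hχr⟩ := exists_heckeCharacter_ideleNorm_cpow (K := K) ((r : ℝ) : ℂ)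
  obtain ⟨π₀, hW₀, -⟩ := exists_cuspidal_detTwist_glOne hcpt ψ
  have hθ₀ := heckeCharacter_detTwist_glOne hW₀
  obtain ⟨P₀, hP₀⟩ := π₀.1.exists_hasArchParameter_glOne
  obtain ⟨-, hP₀cx⟩ := archParam_of_hasUnitaryArchType π₀.1 hθ₀ hψ hP₀
  obtain ⟨π₁, hW₁, hW₁'⟩ := exists_cuspidalAutomorphicRepData_map_mulChar_detTwist hχr π₀
  have hP₁ := AutomorphicRepData.HasArchParameter.of_map_mulChar_detTwist hχr hW₁ hW₁' hP₀
  -- the exponent function `p`, embedding by embedding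
  let p : (K →+* ℂ) → ℂ := fun φ =>
    if φ = (mk φ).embedding then
      (r : ℂ) + ((n (mk φ) : ℂ) + ((-(T (mk φ)) / 2 : ℝ) : ℂ) * Complex.I) / 2
    else (r : ℂ) + (-(n (mk φ) : ℂ) + ((-(T (mk φ)) / 2 : ℝ) : ℂ) * Complex.I) / 2
  have hne_of : ∀ φ : K →+* ℂ, (mk φ).embedding = ComplexEmbedding.conjugate φ →
      φ ≠ (mk φ).embedding := fun φ h hφ => by
    have hc := isComplex_iff.mp (hcx (mk φ))
    rw [← hφ] at hc h
    exact hc (ComplexEmbedding.isReal_iff.mpr h.symm)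
  refine ⟨π₁, p, ?_, fun φ => ?_⟩
  · -- the archimedean parameter of `π₁` is `{p ι}`
    have hfun : (fun σ' => (P₀ σ').map (· + ((r : ℝ) : ℂ))) = fun ι => ({p ι} : Multiset ℂ) := by
      funext φ
      obtain ⟨hemb, hconj⟩ := hP₀cx ⟨mk φ, hcx _⟩
      dsimp only at hemb hconj
      rcases embedding_mk_eq φ with h | h
      · have hp : p φ = (r : ℂ) + ((n (mk φ) : ℂ) + ((-(T (mk φ)) / 2 : ℝ) : ℂ) * Complex.I) / 2 :=
          if_pos h.symm
        rw [hp]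
        conv_lhs => rw [← h]
        rw [hemb, Multiset.map_singleton]
        congr 1
        ring
      · have hp : p φ = (r : ℂ) + (-(n (mk φ) : ℂ) + ((-(T (mk φ)) / 2 : ℝ) : ℂ) * Complex.I) / 2 :=
          if_neg (hne_of φ h)
        have h' : ComplexEmbedding.conjugate (mk φ).embedding = φ := by
          rw [h]; exact ComplexEmbedding.involutive_conjugate _ φ
        rw [hp]
        conv_lhs => rw [← h']
        rw [hconj, Multiset.map_singleton]
        congr 1
        ring
    rw [hfun] at hP₁
    exact hP₁
  · -- half-integrality `p ι + s₁ ι - 1/2 ∈ ℤ` at both embeddings of the place of `ι`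
    have hsum := hEsum (mk φ)
    have h3' := hmII (mk φ).embedding
    have h4' := hMM (mk φ).embedding
    rcases embedding_mk_eq φ with h | h
    · refine ⟨mII (mk φ).embedding + MM (mk φ).embedding, ?_⟩
      have hp : p φ = (r : ℂ) + ((n (mk φ) : ℂ) + ((-(T (mk φ)) / 2 : ℝ) : ℂ) * Complex.I) / 2 :=
        if_pos h.symm
      rw [hp]
      simp only [hn, hr]
      rw [h] at hsum h3' h4' ⊢
      push_cast
      linear_combination (1 / 4 : ℂ) * hsum + (1 / 2 : ℂ) * h3' + (1 / 4 : ℂ) * h4'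
    · refine ⟨-mII (mk φ).embedding, ?_⟩
      have hp : p φ = (r : ℂ) + (-(n (mk φ) : ℂ) + ((-(T (mk φ)) / 2 : ℝ) : ℂ) * Complex.I) / 2 :=
        if_neg (hne_of φ h)
      have h' : ComplexEmbedding.conjugate (mk φ).embedding = φ := by
        rw [h]; exact ComplexEmbedding.involutive_conjugate _ φ
      rw [hp]
      simp only [hn, hr]
      rw [h'] at hsum h3' h4'
      push_cast
      linear_combination (1 / 4 : ℂ) * hsum - (1 / 2 : ℂ) * h3' + (1 / 4 : ℂ) * h4'

/-- **The skeleton theorem**: the crux `HalfIntegralTwistCM`, BY NAME, from the four registered stubs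
(`sorry` lives only inside `stub_*`; when the stubs land this is the crux proof). -/
theorem HalfIntegralTwistCM_of :
    Summit.Langlands.Langlands.Theses.IrreducibilityBySelfDuality.HalfIntegralTwistCM :=
  HalfIntegralTwistCM_of_statements stub_twoPowChevalley stub_weilExtension
    stub_unitRelationCongruence stub_cmDeepUnitsReal

end Summit.Langlands.Langlands.Cruxes.HalfIntegralTwistCM.TwoPrimaryChevalleyCore
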